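import Summits.Ventures.DiscreteObjects.Hadamard.Order167CentralizerFree668

/-!
# H(668): the centraliser of an element of pair order 334 (Ito line) has index ≤ 2 over `⟨g⟩` (kernel)

Framing: lottery ticket; floor = certified bounds/negative ranges.

Cell pub-namedobj (venture DiscreteObjects), target (H), hadamard gen 21.  Let `g = (π, κ, d, e)` be a signed automorphism of a
Hadamard matrix of order `668` whose permutation pair has order `334` (the Ito / negacyclic line, gen 19).  Then `σ := g²` has pair
order `167`, every automorphism commuting with `g` commutes with `σ`, and gen 21's index bound for `C(σ)` (`|C(σ) : ±⟨σ⟩| ≤ 4`,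
`hadamard668_order167_centralizer_index_le_four`) gives, since `g ∉ ⟨σ⟩`:
**`hadamard668_order334_centralizer_index_le_two`** — among any THREE signed automorphisms commuting with `g` (pair level) two are
congruent modulo `⟨g⟩`: `(π_j, κ_j) = (π_i π^c, κ_i κ^c)`.  So `|C(g) : ±⟨g⟩| ≤ 2` (paper reading; the Williamson case attains `2`,
the centraliser pair group being `C₂ × C₃₃₄`).  [Pigeonhole on the five elements `τ₁, τ₂, τ₃, τ₁g, τ₂g` of `C(σ)`; the coincidences
`τ_i ≡ τ_i g (mod ⟨σ⟩)` are impossible because `g` has even order `334` while they would force `g^{odd} = 1`.]  STRUCTURE of a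
hypothetical object; H(668) untouched; HITS 0/4.  Ours; no `sorry`, no definitions, default heartbeats.
-/

namespace Summit.Ventures.DiscreteObjects.Hadamard

open Finset BigOperators Matrix

open Literature.Combinatorics.Designs.GoethalsSeidel (IsHadamardMatrix)

variable {ι : Type*} [Fintype ι] [DecidableEq ι]

section main
variable {H : Matrix ι ι ℤ}

/-- **Index ≤ 2 for the centraliser of an element of pair order 334.** -/
theorem hadamard668_order334_centralizer_index_le_two (hH : IsHadamardMatrix H) (hι : Fintype.card ι = 668)
    {π κ : Equiv.Perm ι} {d e : ι → ℤ} (haut : IsSignedAut H π κ d e)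
    (hord : orderOf ((π, κ) : Equiv.Perm ι × Equiv.Perm ι) = 334)
    (πs κs : Fin 3 → Equiv.Perm ι) (ds es : Fin 3 → ι → ℤ) (hs : ∀ i, IsSignedAut H (πs i) (κs i) (ds i) (es i))
    (hcs : ∀ i, Commute (πs i) π) (hcs' : ∀ i, Commute (κs i) κ) :
    ∃ i j : Fin 3, i ≠ j ∧ ∃ c : ℕ, πs j = πs i * π ^ c ∧ κs j = κs i * κ ^ c := by
  obtain ⟨h334π, h334κ, h2⟩ := pow_data_of_orderOf hord (a := 2) (by norm_num) (by norm_num)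
  -- σ = g²
  have hσπ : (π ^ 2) ^ 167 = 1 := by rw [← pow_mul]; exact h334π
  have hσκ : (κ ^ 2) ^ 167 = 1 := by rw [← pow_mul]; exact h334κ
  have hautσ := isSignedAut_pow haut 2
  -- useful: from (π,κ)^a = (π,κ)^b deduce a ≡ b mod 334
  have hmod : ∀ a b : ℕ, π ^ a = π ^ b → κ ^ a = κ ^ b → a % 334 = b % 334 := by
    intro a b ha hb
    have h : ((π, κ) : Equiv.Perm ι × Equiv.Perm ι) ^ a = ((π, κ) : Equiv.Perm ι × Equiv.Perm ι) ^ b := by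
      rw [Prod.pow_mk, Prod.pow_mk, ha, hb]
    rw [pow_eq_pow_iff_modEq, hord] at h
    exact h
  -- the five elements
  set π5 : Fin 5 → Equiv.Perm ι := fun k => if k.val = 0 then πs 0 else if k.val = 1 then πs 1 else if k.val = 2 then πs 2
    else if k.val = 3 then πs 0 * π else πs 1 * π with hπ5
  set κ5 : Fin 5 → Equiv.Perm ι := fun k => if k.val = 0 then κs 0 else if k.val = 1 then κs 1 else if k.val = 2 then κs 2
    else if k.val = 3 then κs 0 * κ else κs 1 * κ with hκ5
  set d5 : Fin 5 → ι → ℤ := fun k => if k.val = 0 then ds 0 else if k.val = 1 then ds 1 else if k.val = 2 then ds 2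
    else if k.val = 3 then (fun x => ds 0 (π x) * d x) else (fun x => ds 1 (π x) * d x) with hd5
  set e5 : Fin 5 → ι → ℤ := fun k => if k.val = 0 then es 0 else if k.val = 1 then es 1 else if k.val = 2 then es 2
    else if k.val = 3 then (fun y => es 0 (κ y) * e y) else (fun y => es 1 (κ y) * e y) with he5
  have hs5 : ∀ i, IsSignedAut H (π5 i) (κ5 i) (d5 i) (e5 i) := by
    intro i
    fin_cases i <;> norm_num [hπ5, hκ5, hd5, he5]
    · exact hs 0
    · exact hs 1
    · exact hs 2
    · exact isSignedAut_mul (hs 0) haut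
    · exact isSignedAut_mul (hs 1) haut
  have hc5 : ∀ i, Commute (π5 i) (π ^ 2) := by
    intro i
    fin_cases i <;> norm_num [hπ5]
    · exact (hcs 0).pow_right 2
    · exact (hcs 1).pow_right 2
    · exact (hcs 2).pow_right 2
    · exact ((hcs 0).mul_left (Commute.refl π)).pow_right 2
    · exact ((hcs 1).mul_left (Commute.refl π)).pow_right 2
  have hc5' : ∀ i, Commute (κ5 i) (κ ^ 2) := by
    intro i
    fin_cases i <;> norm_num [hκ5]
    · exact (hcs' 0).pow_right 2
    · exact (hcs' 1).pow_right 2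
    · exact (hcs' 2).pow_right 2
    · exact ((hcs' 0).mul_left (Commute.refl κ)).pow_right 2
    · exact ((hcs' 1).mul_left (Commute.refl κ)).pow_right 2
  obtain ⟨i, j, hij, c, hcπ, hcκ⟩ :=
    hadamard668_order167_centralizer_index_le_four hH hι hautσ hσπ hσκ h2 π5 κ5 d5 e5 hs5 hc5 hc5'
  rw [← pow_mul] at hcπ hcκ
  -- algebraic helpers
  have hpow334 : ∀ n : ℕ, π ^ (n + 334) = π ^ n ∧ κ ^ (n + 334) = κ ^ n := fun n => by
    rw [pow_add, pow_add, h334π, h334κ, mul_one, mul_one]; exact ⟨rfl, rfl⟩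
  -- X π = Y π^n ⇒ X = Y π^(n+333)
  have hA : ∀ {X Y : Equiv.Perm ι} {n : ℕ}, X * π = Y * π ^ n → X = Y * π ^ (n + 333) := by
    intro X Y n h
    have h1 : X * π * π ^ 333 = Y * π ^ n * π ^ 333 := by rw [h]
    rw [mul_assoc, ← pow_succ', mul_assoc, ← pow_add, show (333 : ℕ) + 1 = 334 by norm_num, h334π, mul_one] at h1
    exact h1
  have hA' : ∀ {X Y : Equiv.Perm ι} {n : ℕ}, X * κ = Y * κ ^ n → X = Y * κ ^ (n + 333) := by
    intro X Y n h
    have h1 : X * κ * κ ^ 333 = Y * κ ^ n * κ ^ 333 := by rw [h]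
    rw [mul_assoc, ← pow_succ', mul_assoc, ← pow_add, show (333 : ℕ) + 1 = 334 by norm_num, h334κ, mul_one] at h1
    exact h1
  -- X π = Y π π^n ⇒ X = Y π^n
  have hC : ∀ {X Y : Equiv.Perm ι} {n : ℕ}, X * π = Y * π * π ^ n → X = Y * π ^ n := by
    intro X Y n h
    rw [mul_assoc, ← pow_succ', pow_succ, ← mul_assoc] at h
    exact mul_right_cancel h
  have hC' : ∀ {X Y : Equiv.Perm ι} {n : ℕ}, X * κ = Y * κ * κ ^ n → X = Y * κ ^ n := by
    intro X Y n h
    rw [mul_assoc, ← pow_succ', pow_succ, ← mul_assoc] at h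
    exact mul_right_cancel h
  -- X = Y π π^n ⇒ X = Y π^(n+1)
  have hB : ∀ {X Y : Equiv.Perm ι} {n : ℕ}, X = Y * π * π ^ n → X = Y * π ^ (n + 1) := by
    intro X Y n h
    rw [h, mul_assoc, ← pow_succ']
  have hB' : ∀ {X Y : Equiv.Perm ι} {n : ℕ}, X = Y * κ * κ ^ n → X = Y * κ ^ (n + 1) := by
    intro X Y n h
    rw [h, mul_assoc, ← pow_succ']
  -- the contradiction cases: τ ≡ τ g (mod ⟨σ⟩)
  have hno : ∀ {X : Equiv.Perm ι} {Y : Equiv.Perm ι} {n : ℕ}, X * π = X * π ^ n → Y * κ = Y * κ ^ n → n % 2 = 0 → False := by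
    intro X Y n h1 h2 hn
    have e1 : π ^ 1 = π ^ n := by rw [pow_one]; exact mul_left_cancel h1
    have e2 : κ ^ 1 = κ ^ n := by rw [pow_one]; exact mul_left_cancel h2
    have := hmod 1 n e1 e2
    omega
  have hno' : ∀ {X : Equiv.Perm ι} {Y : Equiv.Perm ι} {n : ℕ}, X = X * π * π ^ n → Y = Y * κ * κ ^ n → n % 2 = 0 → False := by
    intro X Y n h1 h2 hn
    have e1 : π ^ 0 = π ^ (n + 1) := by
      rw [pow_zero, pow_succ']
      rw [mul_assoc] at h1
      exact mul_left_cancel (a := X) (by rw [mul_one]; exact h1)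
    have e2 : κ ^ 0 = κ ^ (n + 1) := by
      rw [pow_zero, pow_succ']
      rw [mul_assoc] at h2
      exact mul_left_cancel (a := Y) (by rw [mul_one]; exact h2)
    have := hmod 0 (n + 1) e1 e2
    omega
  -- case analysis on (i, j)
  fin_cases i <;> fin_cases j <;> norm_num [hπ5, hκ5] at hcπ hcκ hij
  all_goals first
    | exact absurd rfl hij
    | exact ⟨0, 1, by decide, 2 * c, hcπ, hcκ⟩
    | exact ⟨0, 2, by decide, 2 * c, hcπ, hcκ⟩
    | exact ⟨1, 0, by decide, 2 * c, hcπ, hcκ⟩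
    | exact ⟨1, 2, by decide, 2 * c, hcπ, hcκ⟩
    | exact ⟨2, 0, by decide, 2 * c, hcπ, hcκ⟩
    | exact ⟨2, 1, by decide, 2 * c, hcπ, hcκ⟩
    | exact (hno hcπ hcκ (by omega)).elim
    | exact absurd (hmod 1 (2 * c) (by rw [pow_one]; exact hcπ) (by rw [pow_one]; exact hcκ)) (by omega)
    | exact ⟨1, 0, by decide, 2 * c, hC hcπ, hC' hcκ⟩
    | exact ⟨0, 1, by decide, 2 * c, hC hcπ, hC' hcκ⟩
    | exact (hno' hcπ hcκ (by omega)).elim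
    | exact ⟨0, 1, by decide, 2 * c + 333, hA hcπ, hA' hcκ⟩
    | exact ⟨1, 0, by decide, 2 * c + 333, hA hcπ, hA' hcκ⟩
    | exact ⟨2, 0, by decide, 2 * c + 333, hA hcπ, hA' hcκ⟩
    | exact ⟨2, 1, by decide, 2 * c + 333, hA hcπ, hA' hcκ⟩
    | exact ⟨0, 1, by decide, 2 * c + 1, hB hcπ, hB' hcκ⟩
    | exact ⟨0, 2, by decide, 2 * c + 1, hB hcπ, hB' hcκ⟩
    | exact ⟨1, 0, by decide, 2 * c + 1, hB hcπ, hB' hcκ⟩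
    | exact ⟨1, 2, by decide, 2 * c + 1, hB hcπ, hB' hcκ⟩

end main

end Summit.Ventures.DiscreteObjects.Hadamard
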